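import Summits.Parity.GeneralizedHardyLittlewood.Theses.LiouvilleMAD
import Summits.Parity.GeneralizedHardyLittlewood.Theses.LiouvilleShiftedTables
import Summits.Parity.GeneralizedHardyLittlewood.Theses.DicksonFibration
import Summits.Parity.GeneralizedHardyLittlewood.Theorems.LiouvilleMADDecorrelationToDilatedChowla
import Summits.Parity.GeneralizedHardyLittlewood.Theorems.LiouvilleMADDilatedChowlaToTypeII
import Summits.Parity.GeneralizedHardyLittlewood.Theorems.LiouvilleMADTypeIIToLevel
import Summits.Parity.GeneralizedHardyLittlewood.Theorems.LiouvilleMADLevelToPairs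

/-!
# Route LiouvilleMAD — the one-piece downstream crux `EngineToGHL` (stmt-Parity-14995):
# the glue is PROVED; what is left is VERBATIM the shared residual `PairsToGHL`

`EngineToGHL` is by definition the conjunction of five implications.  Conjuncts 1–4 are
DEFINITIONALLY the route's four reductions, and all four are now tree theorems:

* `DecorrelationToDilatedChowla` — `decorrelationToDilatedChowla_proof` (stmt-Parity-13321),
* `DilatedChowlaToTypeII` — `dilatedChowlaToTypeII_proof` (stmt-Parity-13323),
* `TypeIIToLevel` — `TypeIIToLevel.TypeIIToLevel_proof` (stmt-Parity-14996),
* `LevelToPairs` — `levelToPairs_proof` (stmt-Parity-14550).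

Conjunct 5 is VERBATIM `LiouvilleShiftedTables.PairsToGHL` (the shared item stmt-Parity-9389:
Hardy–Littlewood pairs at every fixed shift `→ GeneralizedHardyLittlewood`).  Hence, with no
hypothesis at all (`engineToGHL_iff_pairsToGHL`):

  `EngineToGHL ↔ PairsToGHL ↔ (PairsHL → GeneralizedHardyLittlewood) ↔ (PairsHL → DimOne)`,

the last step by the PROVED fibration lemma `DicksonFibration.Assembly_holds`
(`DimOne → GeneralizedHardyLittlewood`, stmt-Parity-0822) and the trivial specialisation
`GeneralizedHardyLittlewood → DimOne` (`d = 1`).  So the crux is exactly as open as the shared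
residual: it holds iff Green–Tao's Conjecture 1.2 follows from binary Hardy–Littlewood at fixed
shifts (prime `k`-tuples for `k ≥ 3`, general slopes, shift-uniformity `|bᵢ| ≤ L N`), i.e. iff
`DimOne` (stmt-Parity-0819) does; and it is refutable only by proving `PairsHL` AND refuting the
summit conjunct (`not_engineToGHL_iff`).

What the route genuinely delivers is recorded unconditionally in the glue:
`pairsHL_of_cosetDecorrelation_of_fanDecorrelation_of_elliottHalberstam` — the two MAD cruxes and
the Elliott–Halberstam conjecture give Hardy–Littlewood pairs `∑_{n ≤ N} Λ(n)Λ(n+h) = 𝔖({0,h}) N + o(N)`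
at every fixed shift `h ≥ 1`.
-/

namespace Summit.Parity.GeneralizedHardyLittlewood.Theorems.EngineToGHL

open Summit.Parity.GeneralizedHardyLittlewood.Theses
open Summit.Parity.GeneralizedHardyLittlewood.Theses.LiouvilleMAD

/-! ### The glue: conjuncts 1–4 are theorems -/

/-- **The glue of `EngineToGHL` is proved.** The four routine reductions of route LiouvilleMAD —
divisor switching (`CosetDecorrelation → FanDecorrelation → DilatedChowla`), Cauchy–Schwarz over the
long variable (`DilatedChowla → TypeIILiouville`), Vaughan/Heath-Brown inside classes with
Bombieri–Vinogradov for `λ` (`TypeIILiouville → LambdaLiouvilleLevel`) and Murty–Vatwani in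
`λ`-form (`LambdaLiouvilleLevel → ElliottHalberstam → PairsHL`) — all hold, by the four tree
theorems closing stmt-Parity-13321 / 13323 / 14996 / 14550. [folklore] -/
theorem glue :
    DecorrelationToDilatedChowla ∧ DilatedChowlaToTypeII ∧ TypeIIToLevel ∧ LevelToPairs :=
  ⟨decorrelationToDilatedChowla_proof, dilatedChowlaToTypeII_proof,
    TypeIIToLevel.TypeIIToLevel_proof, levelToPairs_proof⟩

/-- **MAD ∧ EH ⇒ binary Hardy–Littlewood at every fixed shift.** The two MAD cruxes
`CosetDecorrelation`, `FanDecorrelation` and the Elliott–Halberstam conjecture imply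
`∑_{n ≤ N} Λ(n) Λ(n + h) = 𝔖({0, h}) N + o(N)` for every `h ≥ 1` (the statement
`LiouvilleShiftedTables.PairsHL`, stmt-Parity-9387) — the composite of the four proved reductions;
this is the genuine content of route LiouvilleMAD, unconditional in its bookkeeping. [folklore] -/
theorem pairsHL_of_cosetDecorrelation_of_fanDecorrelation_of_elliottHalberstam
    (h₁ : CosetDecorrelation) (h₂ : FanDecorrelation) (hEH : ElliottHalberstam) :
    LiouvilleShiftedTables.PairsHL :=
  levelToPairs_proof (TypeIIToLevel.TypeIIToLevel_proof
    (dilatedChowlaToTypeII_proof (decorrelationToDilatedChowla_proof h₁ h₂))) hEH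

/-! ### The crux is the shared residual, unconditionally -/

/-- **`EngineToGHL ↔ PairsToGHL`, with no hypothesis.** Since conjuncts 1–4 are theorems
(`glue`) and conjunct 5 is verbatim `LiouvilleShiftedTables.PairsToGHL` (stmt-Parity-9389), the
crux of route LiouvilleMAD is literally equivalent to the shared residual "Hardy–Littlewood pairs at
every fixed shift `→ GeneralizedHardyLittlewood`". [folklore] -/
theorem engineToGHL_iff_pairsToGHL : EngineToGHL ↔ LiouvilleShiftedTables.PairsToGHL :=
  ⟨fun h => h.2.2.2.2, fun hR => ⟨glue.1, glue.2.1, glue.2.2.1, glue.2.2.2, hR⟩⟩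

/-- **The one-stub composition.** Any proof of the shared residual `PairsToGHL`
(stmt-Parity-9389) proves the crux (the honest skeleton of every line for stmt-Parity-14995 has this
single stub). [folklore] -/
theorem engineToGHL_of_pairsToGHL (hR : LiouvilleShiftedTables.PairsToGHL) : EngineToGHL :=
  engineToGHL_iff_pairsToGHL.mpr hR

/-- Conversely the crux dominates the residual: a proof of `EngineToGHL` closes stmt-Parity-9389.
[folklore] -/
theorem pairsToGHL_of_engineToGHL (h : EngineToGHL) : LiouvilleShiftedTables.PairsToGHL :=
  engineToGHL_iff_pairsToGHL.mp h

/-- **Unfolded form.** `EngineToGHL ↔ (PairsHL → GeneralizedHardyLittlewood)`: the crux holds iff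
Green–Tao's Conjecture 1.2 (all `d, t, L`, convex `K`) follows from binary Hardy–Littlewood at
every fixed shift. [folklore] -/
theorem engineToGHL_iff_pairsHL_imp_generalizedHardyLittlewood :
    EngineToGHL ↔ (LiouvilleShiftedTables.PairsHL → _root_.GeneralizedHardyLittlewood) :=
  engineToGHL_iff_pairsToGHL

/-- The summit conjunct implies the crux outright (conjunct 5 := `fun _ => hG`). [folklore] -/
theorem engineToGHL_of_generalizedHardyLittlewood (hG : _root_.GeneralizedHardyLittlewood) :
    EngineToGHL :=
  engineToGHL_of_pairsToGHL fun _ => hG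

/-- Under binary Hardy–Littlewood the crux IS the summit conjunct. [folklore] -/
theorem engineToGHL_iff_generalizedHardyLittlewood_of_pairsHL (hP : LiouvilleShiftedTables.PairsHL) :
    EngineToGHL ↔ _root_.GeneralizedHardyLittlewood :=
  ⟨fun h => pairsToGHL_of_engineToGHL h hP, engineToGHL_of_generalizedHardyLittlewood⟩

/-- Under the route's other `closes` hypotheses (the two MAD cruxes and Elliott–Halberstam, which
give `PairsHL` by the proved glue) the crux is literally equivalent to the summit conjunct
`GeneralizedHardyLittlewood`: nothing short of the full Green–Tao conjecture closes it. [folklore] -/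
theorem engineToGHL_iff_generalizedHardyLittlewood_of_hyps (h₁ : CosetDecorrelation)
    (h₂ : FanDecorrelation) (hEH : ElliottHalberstam) :
    EngineToGHL ↔ _root_.GeneralizedHardyLittlewood :=
  engineToGHL_iff_generalizedHardyLittlewood_of_pairsHL
    (pairsHL_of_cosetDecorrelation_of_fanDecorrelation_of_elliottHalberstam h₁ h₂ hEH)

/-- **What a refutation would be.** `¬EngineToGHL ↔ PairsHL ∧ ¬GeneralizedHardyLittlewood`: an
unconditional disproof of the crux is a PROOF of Hardy–Littlewood pairs at every fixed shift
together with a refutation of Green–Tao's Conjecture 1.2. [folklore] -/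
theorem not_engineToGHL_iff :
    ¬ EngineToGHL ↔ (LiouvilleShiftedTables.PairsHL ∧ ¬ _root_.GeneralizedHardyLittlewood) := by
  rw [engineToGHL_iff_pairsHL_imp_generalizedHardyLittlewood, Classical.not_imp]

/-! ### Modulo the proved fibration lemma the crux is `PairsHL → DimOne` -/

/-- `GeneralizedHardyLittlewood → DimOne`: specialise Green–Tao's Conjecture 1.2 to `d = 1`
(`N ^ 1 = N`). [cite: GreenTao2010, Conj. 1.2] -/
theorem dimOne_of_generalizedHardyLittlewood (hG : _root_.GeneralizedHardyLittlewood) :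
    DicksonFibration.DimOne := by
  intro t L ht ε hε
  obtain ⟨N₀, hN₀⟩ := hG 1 t L le_rfl ht ε hε
  refine ⟨N₀, fun N hN Ψ hΨ hL K hK hKN => ?_⟩
  simpa only [pow_one] using hN₀ N hN Ψ hΨ hL K hK hKN

/-- **`GeneralizedHardyLittlewood ↔ DimOne`** by the PROVED fibration lemma
`DicksonFibration.Assembly_holds : DimOne → GeneralizedHardyLittlewood` (stmt-Parity-0822,
`leeYangFibres_fibrationLemma`): the summit conjunct is its own `d = 1` case. [folklore] -/
theorem generalizedHardyLittlewood_iff_dimOne :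
    _root_.GeneralizedHardyLittlewood ↔ DicksonFibration.DimOne :=
  ⟨dimOne_of_generalizedHardyLittlewood, DicksonFibration.Assembly_holds⟩

/-- **`EngineToGHL ↔ (PairsHL → DimOne)`**, unconditionally: the crux of route LiouvilleMAD is
exactly "binary Hardy–Littlewood at fixed shifts implies Dickson–Hardy–Littlewood for all `t`,
all slopes, shift-uniformly (`|bᵢ| ≤ L N`)" — the open crux `DimOne` (stmt-Parity-0819) of route
DicksonFibration weakened by the hypothesis `PairsHL`. [folklore] -/
theorem engineToGHL_iff_pairsHL_imp_dimOne :
    EngineToGHL ↔ (LiouvilleShiftedTables.PairsHL → DicksonFibration.DimOne) := by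
  rw [engineToGHL_iff_pairsHL_imp_generalizedHardyLittlewood]
  exact ⟨fun h hP => dimOne_of_generalizedHardyLittlewood (h hP),
    fun h hP => DicksonFibration.Assembly_holds (h hP)⟩

/-- `DimOne` (stmt-Parity-0819) implies the crux, by the proved fibration lemma and the proved
glue. [folklore] -/
theorem engineToGHL_of_dimOne (hD : DicksonFibration.DimOne) : EngineToGHL :=
  engineToGHL_of_generalizedHardyLittlewood (DicksonFibration.Assembly_holds hD)

end Summit.Parity.GeneralizedHardyLittlewood.Theorems.EngineToGHL
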